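import Literature.Analysis.FluidPDE.OseenKernelSemigroup
import Literature.Analysis.FluidPDE.KochTataruCarleson
import Literature.Analysis.FluidPDE.KochTataruLinear
import HarnessLib

/-!
# The heat flow of a slice of Koch–Tataru's bilinear term, and its `BMO⁻¹` slices from the estimate (L1)

Analysis/FluidPDE proof companion of `Literature/Analysis/FluidPDE/KochTataru.lean` (the
decomposition of the named fact `Literature.Analysis.FluidPDE.koch_tataru`, **ns.S15**, Koch–Tataru,
Adv. Math. 157 (2001), Theorem 2), a layer of the discharge of **(T3)**
`isKochTataruSolution_of_integral` after `KochTataruPairing.lean` (the bilinear term against test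
fields), parallel to `KochTataruMild.lean` ((T3) ⇐ (T3-bil) `memBMOInvVec_kochTataruBilinear`: the
positive-time slices of `B(u, v)` lie in `BMO⁻¹`). Here the statement of (T3-bil) is **proved from
the bilinear estimate (L1)** `kochTataruBilinear_estimate` (Koch–Tataru's Lemmas 3.1–3.2), so that
(T3) ⇐ (L1) ⇐ (L1-near) `kochTataruBilinear_nearCarleson` of `KochTataruCarleson.lean`. Everything is
**proved**:

* `§ TimeCutoff`: the time cut-off `timeCutoff t u = 1_{τ<t} u` (measurable, `‖·‖_X`-nonincreasing),
  `heatExtension_kochTataruBilinear_eq_setIntegral`: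
  **`e^{sΔ}[B(u,v)(t)](x) = ∫_{(0,t)×E} K(t+s-τ, x-y)[u(τ,y), v(τ,y)] d(τ,y)`** for `t, s > 0` (Fubini
  over `E × ((0,t) × E)` under the majorant of `KochTataruPointwise.lean`, then the semigroup law of
  the kernel `e^{sΔ}K(t-τ) = K(t+s-τ)` of `OseenKernelSemigroup.lean` inside), and
  `heatExtension_kochTataruBilinear`: **`e^{sΔ}[B(u,v)(t)] = B(1_{<t}u, 1_{<t}v)(t + s)`** (the truncated
  fields see only times `< t`) — Koch–Tataru 2001, §3: the caloric extension of `V∇ΠN(u)(t)` is `V∇Π`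
  of the tensor truncated to times `< t`; in Lemarié-Rieusset 2016 the same time shift `W_{ν(t+s)}`
  of the Oseen kernel appears in the proof of Thm. 9.1 (the `𝒜₂`/`𝒜₃` split, p. 216 of the held
  text), and caloric extensions `e^{τΔ}F` of the Duhamel term are what Def. 6.5 ("`F` vanishes at
  infinity": `e^{τΔ}F → 0`) asks about (used by (T4));
* `§ SliceBMOInv`: `eCarlesonNorm_inner_kochTataruBilinear_lt_top` — given (L1), every component
  `g = ⟪B(u,v)(t), w⟫` has finite Carleson quantity: its box `(0,R²) × B(x,R)` is the time-shifted box
  `(t, t+R²) × B(x,R)` of `B_c = B(1_{<t}u, 1_{<t}v)`, inside the box of radius `√2R` when `t ≤ R²`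
  (controlled by `‖B_c‖_X ≤ C‖u‖_X‖v‖_X`, (L1)) and under the pointwise bound (12)
  `|B_c(σ)| ≤ Cσ^{-1/2}‖u‖_X‖v‖_X` when `R² < t`; whence, `g` being bounded (locally integrable,
  tempered), `memBMOInvVec_kochTataruBilinear_of_estimate'`: **given (L1), `B(u,v)(t) ∈ BMO⁻¹(E;E)`
  for `t > 0`**, by the discharged Theorem 1 `memBMOInv_iff_carleson_heat` (fed with the discharged
  (L1) `kochTataruBilinear_estimate_holds` this is the theorem (T3-bil) `memBMOInvVec_kochTataruBilinear`
  of `KochTataruMild.lean`, whence (T3) `isKochTataruSolution_of_integral_holds` there).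

## Mathlib / tree search

Tree: `OseenKernelSemigroup.lean` (`integral_heatKernel_smul_oseenKernel_sub`: the semigroup law of
the kernel, landed while this file was written; an elementary physical-space proof through
`oseenKernel_eq_fderiv_smul_add_integral` — derivatives falling on the Gaussian data — was dropped
in its favour), `KochTataruPairing.lean` (slice lemmas `stronglyMeasurable_kochTataruBilinear_slice`,
`exists_norm_kochTataruBilinear_le`), `KochTataruCarleson.lean` (`eKochTataruNorm_mono`),
`KochTataruPointwise.lean` (majorant, `integrable_oseenKernel_duhamel`,
`exists_enorm_kochTataruBilinear_le`), `KochTataruFixedPoint.lean`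
(`carlesonBox_rpow_le_eKochTataruCarlesonPart`), `KochTataruLinear.lean`
(`inner_heatExtension_eq_heatExtension_inner`, `IsPolynomiallyTempered.inner_const`),
`BMOCarlesonPotential` (`memBMOInv_iff_carleson_heat_holds`), `KochTataruHeatSlice.lean`
(`setLIntegral_Ioo_comp_add`, the same time shift for the free flow). No time cut-off on space–time
fields and no caloric extension of `B` existed (`lean search 'timeCutoff|heatExtension_kochTataruBilinear'`;
`KochTataruDuhamelDecay.lean` announces the identity from a non-existent `KochTataruKernelCalculus.lean`).
Mathlib: `MeasurePreserving.setLIntegral_comp_preimage_emb`, `integral_integral_swap`,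
`Integrable.integral_prod_left`, `setIntegral_indicator`, `Measure.addHaar_ball_of_pos`,
`ENNReal.rpow_le_rpow`, `integrable_rpow_neg_one_add_norm_sq`.

## References

* H. Koch, D. Tataru, *Well-posedness for the Navier–Stokes equations*, Adv. Math. 157 (2001)
  22–35, Theorem 1, §1 (2)–(3), §3 ((11), (12), Lemma 3.2). Bib key `KochTataruAdvMath2001`
  (held: doi:10.1006/aima.2000.1937).
* P. G. Lemarié-Rieusset, *The Navier–Stokes problem in the 21st century*, CRC Press 2016
  (held), Def. 6.5 (vanishing at infinity), Thm. 6.1; Ch. 9, proof of Thm. 9.1 (p. 216 of the held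
  text: the kernels `W_{ν(t+s)}`). Bib key `LemarieRieusset2016`.
-/

noncomputable section

open MeasureTheory Set Function Filter Topology Metric Real TopologicalSpace
open scoped ENNReal NNReal RealInnerProductSpace Laplacian

namespace Literature.Analysis.FluidPDE

variable {E : Type*} [NormedAddCommGroup E] [InnerProductSpace ℝ E]

/-! ## Time truncation and the caloric extension of `B(u, v)(t)` -/

section TimeCutoffDef

/-- The **time cut-off** `1_{τ < t} u` of a time-dependent quantity (the tensor "truncated to
times `< t`"; Koch–Tataru 2001, §3, the cut-offs in time in the proof of Lemma 3.2). [cite: KochTataruAdvMath2001, §3 (proof of Lemma 3.2)] -/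
def timeCutoff {X : Type*} [Zero X] (t : ℝ) (u : ℝ → X) : ℝ → X :=
  (Iio t).indicator u

variable {X : Type*} [Zero X]

/-- Before time `t` the cut-off is the quantity itself. [folklore] -/
theorem timeCutoff_of_lt {t τ : ℝ} (h : τ < t) (u : ℝ → X) : timeCutoff t u τ = u τ :=
  indicator_of_mem (mem_Iio.2 h) u

/-- From time `t` on the cut-off vanishes. [folklore] -/
theorem timeCutoff_of_le {t τ : ℝ} (h : t ≤ τ) (u : ℝ → X) : timeCutoff t u τ = 0 :=
  indicator_of_notMem (fun h' : τ ∈ Iio t => (not_lt.2 h) (mem_Iio.1 h')) u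

omit [InnerProductSpace ℝ E] in
/-- Unfolding the time cut-off of a space–time field. [folklore] -/
theorem timeCutoff_apply (t : ℝ) (u : ℝ → E → E) (τ : ℝ) (y : E) :
    timeCutoff t u τ y = if τ < t then u τ y else 0 := by
  by_cases h : τ < t
  · rw [timeCutoff_of_lt h, if_pos h]
  · rw [timeCutoff_of_le (not_lt.1 h), if_neg h, Pi.zero_apply]

omit [InnerProductSpace ℝ E] in
/-- The time cut-off is pointwise dominated by the field. [folklore] -/
theorem enorm_timeCutoff_le (t : ℝ) (u : ℝ → E → E) (τ : ℝ) (y : E) :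
    ‖timeCutoff t u τ y‖ₑ ≤ ‖u τ y‖ₑ := by
  classical
  rw [timeCutoff_apply]
  split_ifs <;> simp

end TimeCutoffDef

section TimeCutoff

variable [FiniteDimensional ℝ E] [MeasurableSpace E] [BorelSpace E]

/-- The time cut-off does not increase the Koch–Tataru norm. [cite: KochTataruAdvMath2001, (3)] -/
theorem eKochTataruNorm_timeCutoff_le (t : ℝ) (u : ℝ → E → E) :
    eKochTataruNorm (timeCutoff t u) ≤ eKochTataruNorm u :=
  eKochTataruNorm_mono fun τ _ y => enorm_timeCutoff_le t u τ y

/-- The time cut-off preserves measurability on `(0, ∞) × E`. [folklore] -/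
theorem aestronglyMeasurable_timeCutoff (t : ℝ) {u : ℝ → E → E}
    (hu : AEStronglyMeasurable (uncurry u) ((volume : Measure (ℝ × E)).restrict (Ioi 0 ×ˢ univ))) :
    AEStronglyMeasurable (uncurry (timeCutoff t u))
      ((volume : Measure (ℝ × E)).restrict (Ioi 0 ×ˢ univ)) := by
  have h : uncurry (timeCutoff t u) = (Prod.fst ⁻¹' Iio t).indicator (uncurry u) := by
    funext p
    simp only [uncurry, timeCutoff_apply, indicator, mem_preimage, mem_Iio]
  rw [h]
  exact hu.indicator (measurable_fst measurableSet_Iio)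

/-- **The caloric extension of a positive-time slice of `B(u, v)` as a shifted space–time
integral** (Koch–Tataru 2001, §3; the caloric extensions `e^{τΔ}F` of Lemarié-Rieusset 2016,
Def. 6.5, applied to the bilinear term): for `t, s > 0`,
`e^{sΔ}[B(u, v)(t)](x) = ∫_{(0,t) × E} K(t + s - τ, x - y)[u(τ,y), v(τ,y)] d(τ,y)`
(Fubini over `E × ((0,t) × E)` under the majorant of `KochTataruPointwise.lean`, then the semigroup
law of the kernel `e^{sΔ}K(t-τ) = K(t+s-τ)` inside), the Gaussian integrand being integrable
(the time-shifted Oseen kernels `W_{ν(t+s)}` of Lemarié-Rieusset 2016, proof of Thm. 9.1, p. 216). [cite: KochTataruAdvMath2001, §3 (11) and Lemma 3.2] -/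
theorem heatExtension_kochTataruBilinear_eq_setIntegral {u v : ℝ → E → E}
    (hu : AEStronglyMeasurable (uncurry u) ((volume : Measure (ℝ × E)).restrict (Ioi 0 ×ˢ univ)))
    (hv : AEStronglyMeasurable (uncurry v) ((volume : Measure (ℝ × E)).restrict (Ioi 0 ×ˢ univ)))
    (huX : eKochTataruNorm u < ∞) (hvX : eKochTataruNorm v < ∞) {t s : ℝ} (ht : 0 < t) (hs : 0 < s)
    (x : E) :
    Integrable (fun w : E => UnboundedOperators.heatKernel s w • kochTataruBilinear u v t (x - w)) ∧
      UnboundedOperators.heatExtension (kochTataruBilinear u v t) s x =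
        ∫ p in Ioo 0 t ×ˢ univ, oseenKernel (t + s - p.1) (x - p.2) (u p.1 p.2) (v p.1 p.2)
          ∂(volume : Measure (ℝ × E)) := by
  set μ : Measure (ℝ × E) := (volume : Measure (ℝ × E)).restrict (Ioo 0 t ×ˢ univ) with hμ
  set F : E → ℝ × E → E := fun x' p => oseenKernel (t - p.1) (x' - p.2) (u p.1 p.2) (v p.1 p.2) with hF
  -- `B(u,v)(t,x')` as an integral over `(0,t) × E`
  have hB : ∀ x', kochTataruBilinear u v t x' = ∫ p, F x' p ∂μ := by
    intro x'
    have hint := integrable_oseenKernel_duhamel hu hv huX hvX ht x'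
    rw [FluidPDE.volume_restrict_prod_univ_eq_prod] at hint
    rw [hμ, FluidPDE.volume_restrict_prod_univ_eq_prod, integral_prod _ hint]
    rfl
  -- measurability of the Gaussian integrand on `E × ((0,t) × E)`
  have hsub : Ioo (0 : ℝ) t ×ˢ (univ : Set E) ⊆ Ioi 0 ×ˢ univ := prod_mono Ioo_subset_Ioi_self subset_rfl
  have hu' : AEStronglyMeasurable (fun p : ℝ × E => u p.1 p.2) μ := hu.mono_measure (Measure.restrict_mono hsub le_rfl)
  have hv' : AEStronglyMeasurable (fun p : ℝ × E => v p.1 p.2) μ := hv.mono_measure (Measure.restrict_mono hsub le_rfl)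
  set G : E → ℝ × E → E := fun w p => UnboundedOperators.heatKernel s w • F (x - w) p with hG
  have hGm : AEStronglyMeasurable (uncurry G) ((volume : Measure E).prod μ) := by
    have hK : AEMeasurable (fun q : E × (ℝ × E) => F (x - q.1) q.2) ((volume : Measure E).prod μ) := by
      refine AEMeasurable.oseenKernel_comp ?_ ?_ ?_ ?_
      · exact (measurable_const.sub measurable_snd.fst).aemeasurable
      · exact ((measurable_const.sub measurable_fst).sub measurable_snd.snd).aemeasurable
      · exact (hu'.comp_snd (μ := (volume : Measure E))).aemeasurable
      · exact (hv'.comp_snd (μ := (volume : Measure E))).aemeasurable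
    exact (((UnboundedOperators.continuous_heatKernel s).measurable.comp measurable_fst).aemeasurable.smul hK)
      |>.aestronglyMeasurable
  -- integrability on the product, by Tonelli and the majorant (uniform in the space point)
  have hprod : Integrable (uncurry G) ((volume : Measure E).prod μ) := by
    obtain ⟨C, hC, hmaj⟩ := exists_lintegral_enorm_oseenKernel_duhamel_le (E := E)
    set M : ℝ≥0∞ := ENNReal.ofReal (C * t ^ (-(1 / 2 : ℝ))) * eKochTataruNorm u * eKochTataruNorm v with hM
    have hMtop : M < ∞ := ENNReal.mul_lt_top (ENNReal.mul_lt_top ENNReal.ofReal_lt_top huX) hvX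
    refine ⟨hGm, ?_⟩
    rw [hasFiniteIntegral_iff_enorm, lintegral_prod _ hGm.enorm]
    have hGi : ∫⁻ w, ‖UnboundedOperators.heatKernel s w‖ₑ ∂(volume : Measure E) < ∞ :=
      (UnboundedOperators.integrable_heatKernel_holds (E := E) hs).2
    calc ∫⁻ w, ∫⁻ p, ‖uncurry G (w, p)‖ₑ ∂μ
        = ∫⁻ w, ∫⁻ p, ‖UnboundedOperators.heatKernel s w‖ₑ * ‖F (x - w) p‖ₑ ∂μ := by
          refine lintegral_congr fun w => lintegral_congr fun p => ?_
          simp only [hG, uncurry_apply_pair, enorm_smul]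
      _ = ∫⁻ w, ‖UnboundedOperators.heatKernel s w‖ₑ * ∫⁻ p, ‖F (x - w) p‖ₑ ∂μ := by
          refine lintegral_congr fun w => ?_
          rw [lintegral_const_mul'' _ ?_]
          have : AEStronglyMeasurable (fun p => F (x - w) p) μ := aestronglyMeasurable_oseenKernel_duhamel hu hv t (x - w)
          exact this.enorm
      _ ≤ ∫⁻ w, ‖UnboundedOperators.heatKernel s w‖ₑ * M := by
          refine lintegral_mono fun w => ?_
          gcongr
          exact hmaj hu hv ht (x - w)
      _ = (∫⁻ w, ‖UnboundedOperators.heatKernel s w‖ₑ) * M := lintegral_mul_const' _ _ hMtop.ne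
      _ < ∞ := ENNReal.mul_lt_top hGi hMtop
  have hint : Integrable (fun w : E => UnboundedOperators.heatKernel s w • kochTataruBilinear u v t (x - w)) := by
    refine hprod.integral_prod_left.congr (Eventually.of_forall fun w => ?_)
    simp only [hG, uncurry_apply_pair]
    rw [integral_smul, hB (x - w)]
  refine ⟨hint, ?_⟩
  calc UnboundedOperators.heatExtension (kochTataruBilinear u v t) s x
      = ∫ w, ∫ p, G w p ∂μ := by
        rw [UnboundedOperators.heatExtension_apply]
        refine integral_congr_ae (Eventually.of_forall fun w => ?_)
        simp only [hG, hB (x - w), ← integral_smul]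
    _ = ∫ p, (∫ w, G w p) ∂μ := integral_integral_swap hprod
    _ = ∫ p, oseenKernel (t + s - p.1) (x - p.2) (u p.1 p.2) (v p.1 p.2) ∂μ := by
        refine setIntegral_congr_fun (measurableSet_Ioo.prod MeasurableSet.univ) fun p hp => ?_
        rw [mem_prod] at hp
        have hσ : 0 < t - p.1 := sub_pos.2 hp.1.2
        have h := integral_heatKernel_smul_oseenKernel_sub hσ hs (u p.1 p.2) (v p.1 p.2) (x - p.2)
        simp only [hG, hF]
        rw [show t + s - p.1 = t - p.1 + s by ring, ← h]
        refine integral_congr_ae (Eventually.of_forall fun w => ?_)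
        beta_reduce
        rw [sub_right_comm x w p.2]

/-- **`B` of the time-truncated fields at a later time is the same shifted space–time integral**:
for `t, s > 0`, `B(1_{<t}u, 1_{<t}v)(t + s, x) = ∫_{(0,t) × E} K(t + s - τ, x - y)[u(τ,y), v(τ,y)] d(τ,y)`
(the truncated fields see only times `< t`). [cite: KochTataruAdvMath2001, §3 (11)] -/
theorem kochTataruBilinear_timeCutoff_eq_setIntegral {u v : ℝ → E → E}
    (hu : AEStronglyMeasurable (uncurry u) ((volume : Measure (ℝ × E)).restrict (Ioi 0 ×ˢ univ)))
    (hv : AEStronglyMeasurable (uncurry v) ((volume : Measure (ℝ × E)).restrict (Ioi 0 ×ˢ univ)))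
    (huX : eKochTataruNorm u < ∞) (hvX : eKochTataruNorm v < ∞) {t s : ℝ} (ht : 0 < t) (hs : 0 < s)
    (x : E) :
    kochTataruBilinear (timeCutoff t u) (timeCutoff t v) (t + s) x =
      ∫ p in Ioo 0 t ×ˢ univ, oseenKernel (t + s - p.1) (x - p.2) (u p.1 p.2) (v p.1 p.2)
        ∂(volume : Measure (ℝ × E)) := by
  set μ : Measure (ℝ × E) := (volume : Measure (ℝ × E)).restrict (Ioo 0 t ×ˢ univ) with hμ
  set uc := timeCutoff t u with huc
  set vc := timeCutoff t v with hvc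
  have hucm := aestronglyMeasurable_timeCutoff t hu
  have hvcm := aestronglyMeasurable_timeCutoff t hv
  have hucX : eKochTataruNorm uc < ∞ := (eKochTataruNorm_timeCutoff_le t u).trans_lt huX
  have hvcX : eKochTataruNorm vc < ∞ := (eKochTataruNorm_timeCutoff_le t v).trans_lt hvX
  have hts : 0 < t + s := by linarith
  -- the inner integral vanishes from time `t` on
  have hinner : ∀ τ, ∫ y, oseenKernel (t + s - τ) (x - y) (uc τ y) (vc τ y) =
      (Iio t).indicator (fun τ => ∫ y, oseenKernel (t + s - τ) (x - y) (u τ y) (v τ y)) τ := by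
    intro τ
    by_cases hτ : τ < t
    · rw [indicator_of_mem (mem_Iio.2 hτ), huc, hvc, timeCutoff_of_lt hτ, timeCutoff_of_lt hτ]
    · rw [indicator_of_notMem (fun h : τ ∈ Iio t => hτ (mem_Iio.1 h)), huc, hvc,
        timeCutoff_of_le (not_lt.1 hτ), timeCutoff_of_le (not_lt.1 hτ)]
      simp
  unfold kochTataruBilinear
  simp_rw [hinner]
  rw [setIntegral_indicator measurableSet_Iio, show Ioo 0 (t + s) ∩ Iio t = Ioo 0 t from ?_]
  swap
  · ext τ
    simp only [mem_inter_iff, mem_Ioo, mem_Iio]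
    constructor
    · rintro ⟨⟨h1, -⟩, h2⟩; exact ⟨h1, h2⟩
    · rintro ⟨h1, h2⟩; exact ⟨⟨h1, by linarith⟩, h2⟩
  -- back to the product integral
  have hintP : Integrable (fun p : ℝ × E => oseenKernel (t + s - p.1) (x - p.2) (u p.1 p.2) (v p.1 p.2)) μ := by
    have h := integrable_oseenKernel_duhamel hucm hvcm hucX hvcX hts x
    have hsub' : Ioo (0 : ℝ) t ×ˢ (univ : Set E) ⊆ Ioo 0 (t + s) ×ˢ univ :=
      prod_mono (Ioo_subset_Ioo le_rfl (by linarith)) subset_rfl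
    have h' := h.mono_measure (Measure.restrict_mono hsub' le_rfl)
    refine h'.congr ?_
    filter_upwards [ae_restrict_mem (measurableSet_Ioo.prod MeasurableSet.univ)] with p hp
    rw [mem_prod] at hp
    rw [timeCutoff_of_lt hp.1.2, timeCutoff_of_lt hp.1.2]
  have hintP' : Integrable (fun p : ℝ × E => oseenKernel (t + s - p.1) (x - p.2) (u p.1 p.2) (v p.1 p.2))
      (((volume : Measure ℝ).restrict (Ioo 0 t)).prod (volume : Measure E)) := by
    rwa [hμ, FluidPDE.volume_restrict_prod_univ_eq_prod] at hintP
  rw [hμ, FluidPDE.volume_restrict_prod_univ_eq_prod, integral_prod _ hintP']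

/-- **The caloric extension of a positive-time slice of `B(u, v)` is `B` of the time-truncated
fields at the later time** (Koch–Tataru 2001, §3: the caloric extension of `V∇ΠN(u)(t)` is `V∇Π`
of the tensor truncated to times `< t`; the time-shifted kernels `W_{ν(t+s)}` of Lemarié-Rieusset
2016, proof of Thm. 9.1, p. 216): for `t, s > 0`,
`e^{sΔ}[B(u, v)(t)](x) = B(1_{<t}u, 1_{<t}v)(t + s, x)`. [cite: KochTataruAdvMath2001, §3 (11) and Lemma 3.2] -/
theorem heatExtension_kochTataruBilinear {u v : ℝ → E → E}
    (hu : AEStronglyMeasurable (uncurry u) ((volume : Measure (ℝ × E)).restrict (Ioi 0 ×ˢ univ)))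
    (hv : AEStronglyMeasurable (uncurry v) ((volume : Measure (ℝ × E)).restrict (Ioi 0 ×ˢ univ)))
    (huX : eKochTataruNorm u < ∞) (hvX : eKochTataruNorm v < ∞) {t s : ℝ} (ht : 0 < t) (hs : 0 < s)
    (x : E) :
    UnboundedOperators.heatExtension (kochTataruBilinear u v t) s x =
      kochTataruBilinear (timeCutoff t u) (timeCutoff t v) (t + s) x := by
  rw [(heatExtension_kochTataruBilinear_eq_setIntegral hu hv huX hvX ht hs x).2,
    kochTataruBilinear_timeCutoff_eq_setIntegral hu hv huX hvX ht hs x]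

end TimeCutoff

/-! ## (T3-bil) from the bilinear estimate (L1): `B(u, v)(t) ∈ BMO⁻¹` -/

section SliceBMOInv

variable [FiniteDimensional ℝ E] [MeasurableSpace E] [BorelSpace E]

/-- A bounded strongly measurable field is polynomially tempered (against `(1 + ‖y‖²)^{-N}`,
`2N > d`). [folklore] -/
theorem isPolynomiallyTempered_of_bounded {f : E → E} (hf : StronglyMeasurable f) {B : ℝ}
    (hB : ∀ y, ‖f y‖ ≤ B) : IsPolynomiallyTempered f := by
  set d : ℕ := Module.finrank ℝ E with hd
  obtain ⟨N, hN⟩ : ∃ N : ℕ, (d : ℝ) < 2 * N := ⟨d + 1, by push_cast; linarith⟩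
  have hweight : Integrable fun y : E => ((1 + ‖y‖ ^ 2) ^ N : ℝ)⁻¹ := by
    have h := integrable_rpow_neg_one_add_norm_sq (E := E) (μ := volume) (r := 2 * N) (by exact_mod_cast hN)
    refine h.congr (Eventually.of_forall fun y => ?_)
    have h1 : (0 : ℝ) < 1 + ‖y‖ ^ 2 := by positivity
    beta_reduce
    rw [← Real.rpow_natCast _ N, ← Real.rpow_neg h1.le]
    congr 1
    ring
  refine ⟨N, (hweight.norm.mul_const B).mono' (hweight.1.smul hf.aestronglyMeasurable)
    (Eventually.of_forall fun y => ?_)⟩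
  rw [norm_smul]
  gcongr
  exact hB y

/-- A bounded strongly measurable real function is locally integrable. [folklore] -/
theorem locallyIntegrable_of_bounded_real {g : E → ℝ} (hg : StronglyMeasurable g) {B : ℝ}
    (hB : ∀ y, ‖g y‖ ≤ B) : LocallyIntegrable g volume := by
  refine (locallyIntegrable_iff).2 fun k hk => ?_
  exact Measure.integrableOn_of_bounded hk.measure_lt_top.ne hg.aestronglyMeasurable
    (Eventually.of_forall hB)

/-- `a^{1/2} ≤ N` gives `a ≤ N²` in `ℝ≥0∞`. [folklore] -/
theorem ennreal_le_sq_of_rpow_half_le {a N : ℝ≥0∞} (h : a ^ (1 / 2 : ℝ) ≤ N) : a ≤ N ^ 2 := by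
  calc a = (a ^ (1 / 2 : ℝ)) ^ (2 : ℝ) := by rw [← ENNReal.rpow_mul]; norm_num
    _ ≤ N ^ (2 : ℝ) := ENNReal.rpow_le_rpow h (by norm_num)
    _ = N ^ 2 := by rw [show (2 : ℝ) = ((2 : ℕ) : ℝ) by norm_num, ENNReal.rpow_natCast]

open FunctionSpaces.BMOInv in
/-- **The Carleson quantity of a component of `B(u, v)(t)` is finite, given the bilinear estimate
(L1)** (Koch–Tataru 2001, (2)–(3), Lemma 3.2 and (12)): with `B_c = B(1_{<t}u, 1_{<t}v)` and
`g = ⟪B(u,v)(t), w⟫`, `e^{sΔ}g = ⟪B_c(t+s), w⟫` (`heatExtension_kochTataruBilinear`), so the Carleson box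
`(0,R²) × B(x,R)` of `g` is the time-shifted box `(t, t+R²) × B(x,R)` of `B_c`: inside the box of
radius `√2R` when `t ≤ R²` (controlled by `‖B_c‖_X ≤ C‖u‖_X‖v‖_X`, the estimate (L1)), and carrying
the pointwise bound (12) `|B_c(σ)| ≤ Cσ^{-1/2}‖u‖_X‖v‖_X ≤ Ct^{-1/2}‖u‖_X‖v‖_X` when `R² < t`. [cite: KochTataruAdvMath2001, §1 (2)–(3), Lemma 3.2 and (12)] -/
theorem eCarlesonNorm_inner_kochTataruBilinear_lt_top (hL1 : kochTataruBilinear_estimate E)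
    {u v : ℝ → E → E}
    (hu : AEStronglyMeasurable (uncurry u) ((volume : Measure (ℝ × E)).restrict (Ioi 0 ×ˢ univ)))
    (hv : AEStronglyMeasurable (uncurry v) ((volume : Measure (ℝ × E)).restrict (Ioi 0 ×ˢ univ)))
    (huX : eKochTataruNorm u < ∞) (hvX : eKochTataruNorm v < ∞) {t : ℝ} (ht : 0 < t) (w : E) :
    eCarlesonNorm (fun y => ⟪kochTataruBilinear u v t y, w⟫) < ∞ := by
  set d : ℕ := Module.finrank ℝ E with hd
  obtain ⟨C₁, hC₁⟩ := hL1
  set uc := timeCutoff t u with huc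
  set vc := timeCutoff t v with hvc
  have hucm := aestronglyMeasurable_timeCutoff t hu
  have hvcm := aestronglyMeasurable_timeCutoff t hv
  have hucX : eKochTataruNorm uc ≤ eKochTataruNorm u := eKochTataruNorm_timeCutoff_le t u
  have hvcX : eKochTataruNorm vc ≤ eKochTataruNorm v := eKochTataruNorm_timeCutoff_le t v
  set Bc := kochTataruBilinear uc vc with hBc
  -- the `X`-norm of `B_c` (the estimate (L1))
  set NX : ℝ≥0∞ := (C₁ : ℝ≥0∞) * eKochTataruNorm u * eKochTataruNorm v with hNX
  have hNXtop : NX < ∞ := ENNReal.mul_lt_top (ENNReal.mul_lt_top ENNReal.coe_lt_top huX) hvX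
  have hBcX : eKochTataruNorm Bc ≤ NX :=
    ((hC₁ uc vc hucm hvcm (hucX.trans_lt huX) (hvcX.trans_lt hvX)).2.2).trans (by rw [hNX]; gcongr)
  -- the pointwise bound (12) on `B_c`
  obtain ⟨C₂, hC₂, hpt⟩ := exists_enorm_kochTataruBilinear_le (E := E)
  set P : ℝ≥0∞ := ENNReal.ofReal (C₂ * t ^ (-(1 / 2 : ℝ))) * eKochTataruNorm u * eKochTataruNorm v with hP
  have hPtop : P < ∞ := ENNReal.mul_lt_top (ENNReal.mul_lt_top ENNReal.ofReal_lt_top huX) hvX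
  have hptσ : ∀ σ, t ≤ σ → ∀ y, ‖Bc σ y‖ₑ ≤ P := by
    intro σ hσ y
    have hσ0 : 0 < σ := ht.trans_le hσ
    refine (hpt hucm hvcm hσ0 y).trans ?_
    rw [hP]
    gcongr ?_ * ?_ * ?_
    · refine ENNReal.ofReal_le_ofReal (mul_le_mul_of_nonneg_left ?_ hC₂.le)
      exact Real.rpow_le_rpow_of_nonpos ht hσ (by norm_num)
  -- the slice and its caloric extensions
  have hftemp : IsPolynomiallyTempered (kochTataruBilinear u v t) := by
    obtain ⟨B, -, hB⟩ := exists_norm_kochTataruBilinear_le hu hv huX hvX ht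
    exact isPolynomiallyTempered_of_bounded (stronglyMeasurable_kochTataruBilinear_slice hu hv t) hB
  have hext : ∀ s, 0 < s → ∀ y, heatExtension (fun y => ⟪kochTataruBilinear u v t y, w⟫) s y = ⟪Bc (t + s) y, w⟫ := by
    intro s hs y
    rw [← inner_heatExtension_eq_heatExtension_inner hftemp hs y w,
      heatExtension_kochTataruBilinear hu hv huX hvX ht hs y]
  set V : ℝ≥0∞ := volume (ball (0 : E) 1) with hV
  have hVtop : V < ∞ := measure_ball_lt_top
  -- the bound on one box
  have hbox : ∀ (x : E) (R : ℝ), 0 < R →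
      (ENNReal.ofReal (R ^ d))⁻¹ * ∫⁻ s in Ioo 0 (R ^ 2), ∫⁻ y in ball x R,
          ‖heatExtension (fun y => ⟪kochTataruBilinear u v t y, w⟫) s y‖ₑ ^ 2 ≤
        ‖w‖ₑ ^ 2 * (ENNReal.ofReal ((Real.sqrt 2) ^ d) * NX ^ 2 + ENNReal.ofReal t * V * P ^ 2) := by
    intro x R hR
    have hRd : 0 < R ^ d := by positivity
    have hRdtop : ENNReal.ofReal (R ^ d) ≠ ∞ := ENNReal.ofReal_ne_top
    have hRd0 : ENNReal.ofReal (R ^ d) ≠ 0 := (ENNReal.ofReal_pos.2 hRd).ne'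
    -- through the caloric extension identity and Cauchy–Schwarz in `E`
    have hstep1 : ∫⁻ s in Ioo 0 (R ^ 2), ∫⁻ y in ball x R,
        ‖heatExtension (fun y => ⟪kochTataruBilinear u v t y, w⟫) s y‖ₑ ^ 2 ≤
        ‖w‖ₑ ^ 2 * ∫⁻ σ in Ioo t (t + R ^ 2), ∫⁻ y in ball x R, ‖Bc σ y‖ₑ ^ 2 := by
      have h1 : ∫⁻ s in Ioo 0 (R ^ 2), ∫⁻ y in ball x R,
          ‖heatExtension (fun y => ⟪kochTataruBilinear u v t y, w⟫) s y‖ₑ ^ 2 ≤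
          ∫⁻ s in Ioo 0 (R ^ 2), ∫⁻ y in ball x R, ‖w‖ₑ ^ 2 * ‖Bc (s + t) y‖ₑ ^ 2 := by
        refine setLIntegral_mono' measurableSet_Ioo fun s hs => lintegral_mono fun y => ?_
        rw [hext s hs.1 y, add_comm s t]
        calc ‖⟪Bc (t + s) y, w⟫‖ₑ ^ 2 ≤ (‖Bc (t + s) y‖ₑ * ‖w‖ₑ) ^ 2 := by
              gcongr
              rw [← ofReal_norm, ← ofReal_norm, ← ofReal_norm, ← ENNReal.ofReal_mul (norm_nonneg _)]
              exact ENNReal.ofReal_le_ofReal ((Real.norm_eq_abs _).trans_le (abs_real_inner_le_norm _ _))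
          _ = ‖w‖ₑ ^ 2 * ‖Bc (t + s) y‖ₑ ^ 2 := by ring
      refine h1.trans (le_of_eq ?_)
      have h2 : ∫⁻ s in Ioo 0 (R ^ 2), ∫⁻ y in ball x R, ‖w‖ₑ ^ 2 * ‖Bc (s + t) y‖ₑ ^ 2 =
          ‖w‖ₑ ^ 2 * ∫⁻ s in Ioo 0 (R ^ 2), ∫⁻ y in ball x R, ‖Bc (s + t) y‖ₑ ^ 2 := by
        rw [← lintegral_const_mul' _ _ (by simp)]
        refine lintegral_congr fun s => ?_
        rw [lintegral_const_mul' _ _ (by simp)]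
      rw [h2]
      congr 1
      have h3 := (measurePreserving_add_right (volume : Measure ℝ) t).setLIntegral_comp_preimage_emb
        (measurableEmbedding_addRight t) (fun σ => ∫⁻ y in ball x R, ‖Bc σ y‖ₑ ^ 2) (Ioo t (t + R ^ 2))
      rw [preimage_add_const_Ioo] at h3
      simpa using h3
    have hstep2 : (ENNReal.ofReal (R ^ d))⁻¹ * ∫⁻ s in Ioo 0 (R ^ 2), ∫⁻ y in ball x R,
        ‖heatExtension (fun y => ⟪kochTataruBilinear u v t y, w⟫) s y‖ₑ ^ 2 ≤
        ‖w‖ₑ ^ 2 * ((ENNReal.ofReal (R ^ d))⁻¹ * ∫⁻ σ in Ioo t (t + R ^ 2), ∫⁻ y in ball x R, ‖Bc σ y‖ₑ ^ 2) := by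
      calc (ENNReal.ofReal (R ^ d))⁻¹ * ∫⁻ s in Ioo 0 (R ^ 2), ∫⁻ y in ball x R,
            ‖heatExtension (fun y => ⟪kochTataruBilinear u v t y, w⟫) s y‖ₑ ^ 2
          ≤ (ENNReal.ofReal (R ^ d))⁻¹ * (‖w‖ₑ ^ 2 * ∫⁻ σ in Ioo t (t + R ^ 2), ∫⁻ y in ball x R, ‖Bc σ y‖ₑ ^ 2) := by
            gcongr
        _ = _ := by ring
    refine hstep2.trans ?_
    gcongr ‖w‖ₑ ^ 2 * ?_
    rcases le_or_gt t (R ^ 2) with htR | htR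
    · -- `t ≤ R²`: inside the box of radius `√2 R`, controlled by `‖B_c‖_X`
      set R' : ℝ := Real.sqrt 2 * R with hR'
      have hR'0 : 0 < R' := by positivity
      have hR'2 : R' ^ 2 = 2 * R ^ 2 := by rw [hR', mul_pow, Real.sq_sqrt (by norm_num : (0 : ℝ) ≤ 2)]
      have hsub1 : Ioo t (t + R ^ 2) ⊆ Ioo 0 (R' ^ 2) := by
        rw [hR'2]; exact Ioo_subset_Ioo ht.le (by linarith)
      have hsub2 : ball x R ⊆ ball x R' := ball_subset_ball (by
        rw [hR']
        have : (1 : ℝ) ≤ Real.sqrt 2 := by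
          rw [show (1 : ℝ) = Real.sqrt 1 by simp]; exact Real.sqrt_le_sqrt (by norm_num)
        nlinarith)
      have hR'd0 : ENNReal.ofReal (R' ^ d) ≠ 0 := (ENNReal.ofReal_pos.2 (by positivity)).ne'
      have hbig : (ENNReal.ofReal (R' ^ d))⁻¹ *
          ∫⁻ σ in Ioo 0 (R' ^ 2), ∫⁻ y in ball x R', ‖Bc σ y‖ₑ ^ 2 ≤ NX ^ 2 :=
        ennreal_le_sq_of_rpow_half_le
          (((carlesonBox_rpow_le_eKochTataruCarlesonPart Bc x hR'0).trans (eKochTataruCarlesonPart_le Bc)).trans hBcX)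
      have hI : ∫⁻ σ in Ioo 0 (R' ^ 2), ∫⁻ y in ball x R', ‖Bc σ y‖ₑ ^ 2 ≤ ENNReal.ofReal (R' ^ d) * NX ^ 2 := by
        calc ∫⁻ σ in Ioo 0 (R' ^ 2), ∫⁻ y in ball x R', ‖Bc σ y‖ₑ ^ 2
            = ENNReal.ofReal (R' ^ d) * ((ENNReal.ofReal (R' ^ d))⁻¹ *
                ∫⁻ σ in Ioo 0 (R' ^ 2), ∫⁻ y in ball x R', ‖Bc σ y‖ₑ ^ 2) := by
              rw [← mul_assoc, ENNReal.mul_inv_cancel hR'd0 ENNReal.ofReal_ne_top, one_mul]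
          _ ≤ ENNReal.ofReal (R' ^ d) * NX ^ 2 := by gcongr
      have hRR' : ENNReal.ofReal (R' ^ d) = ENNReal.ofReal ((Real.sqrt 2) ^ d) * ENNReal.ofReal (R ^ d) := by
        rw [hR', mul_pow, ENNReal.ofReal_mul (by positivity)]
      calc (ENNReal.ofReal (R ^ d))⁻¹ * ∫⁻ σ in Ioo t (t + R ^ 2), ∫⁻ y in ball x R, ‖Bc σ y‖ₑ ^ 2
          ≤ (ENNReal.ofReal (R ^ d))⁻¹ * ∫⁻ σ in Ioo 0 (R' ^ 2), ∫⁻ y in ball x R', ‖Bc σ y‖ₑ ^ 2 := by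
            gcongr ?_ * ?_
            · exact le_rfl
            · exact (lintegral_mono_set hsub1).trans (lintegral_mono fun σ => lintegral_mono_set hsub2)
        _ ≤ (ENNReal.ofReal (R ^ d))⁻¹ * (ENNReal.ofReal (R' ^ d) * NX ^ 2) := by gcongr
        _ = ENNReal.ofReal ((Real.sqrt 2) ^ d) * NX ^ 2 := by
            rw [hRR', ← mul_assoc, ← mul_assoc, mul_comm _ (ENNReal.ofReal (Real.sqrt 2 ^ d)),
              mul_assoc (ENNReal.ofReal (Real.sqrt 2 ^ d)), ENNReal.inv_mul_cancel hRd0 hRdtop, mul_one]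
        _ ≤ _ := le_self_add
    · -- `R² < t`: the pointwise bound (12) on `σ ≥ t`
      have hinner : ∀ σ ∈ Ioo t (t + R ^ 2), ∫⁻ y in ball x R, ‖Bc σ y‖ₑ ^ 2 ≤ P ^ 2 * (ENNReal.ofReal (R ^ d) * V) := by
        intro σ hσ
        calc ∫⁻ y in ball x R, ‖Bc σ y‖ₑ ^ 2 ≤ ∫⁻ _y in ball x R, P ^ 2 :=
              setLIntegral_mono' measurableSet_ball fun y _ => by gcongr; exact hptσ σ hσ.1.le y
          _ = P ^ 2 * (ENNReal.ofReal (R ^ d) * V) := by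
              rw [setLIntegral_const, Measure.addHaar_ball_of_pos _ x hR, hd]
      calc (ENNReal.ofReal (R ^ d))⁻¹ * ∫⁻ σ in Ioo t (t + R ^ 2), ∫⁻ y in ball x R, ‖Bc σ y‖ₑ ^ 2
          ≤ (ENNReal.ofReal (R ^ d))⁻¹ * ∫⁻ _σ in Ioo t (t + R ^ 2), P ^ 2 * (ENNReal.ofReal (R ^ d) * V) := by
            gcongr ?_ * ?_
            · exact le_rfl
            · exact setLIntegral_mono' measurableSet_Ioo hinner
        _ = (ENNReal.ofReal (R ^ d))⁻¹ * (P ^ 2 * (ENNReal.ofReal (R ^ d) * V) * ENNReal.ofReal (R ^ 2)) := by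
            rw [setLIntegral_const, Real.volume_Ioo, add_sub_cancel_left]
        _ = ENNReal.ofReal (R ^ 2) * V * P ^ 2 := by
            calc (ENNReal.ofReal (R ^ d))⁻¹ * (P ^ 2 * (ENNReal.ofReal (R ^ d) * V) * ENNReal.ofReal (R ^ 2))
                = ((ENNReal.ofReal (R ^ d))⁻¹ * ENNReal.ofReal (R ^ d)) * (ENNReal.ofReal (R ^ 2) * V * P ^ 2) := by
                  ring
              _ = ENNReal.ofReal (R ^ 2) * V * P ^ 2 := by rw [ENNReal.inv_mul_cancel hRd0 hRdtop, one_mul]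
        _ ≤ ENNReal.ofReal t * V * P ^ 2 := by gcongr
        _ ≤ _ := le_add_self
  have hle : eCarlesonNorm (fun y => ⟪kochTataruBilinear u v t y, w⟫) ≤
      ‖w‖ₑ ^ 2 * (ENNReal.ofReal ((Real.sqrt 2) ^ d) * NX ^ 2 + ENNReal.ofReal t * V * P ^ 2) := by
    rw [eCarlesonNorm]
    exact iSup_le fun x => iSup₂_le fun R hR => hbox x R hR
  refine hle.trans_lt (ENNReal.mul_lt_top (ENNReal.pow_lt_top enorm_lt_top) ?_)
  refine ENNReal.add_lt_top.2 ⟨ENNReal.mul_lt_top ENNReal.ofReal_lt_top (ENNReal.pow_lt_top hNXtop), ?_⟩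
  exact ENNReal.mul_lt_top (ENNReal.mul_lt_top ENNReal.ofReal_lt_top hVtop) (ENNReal.pow_lt_top hPtop)

/-- **(T3-bil) from the bilinear estimate (L1)** (Koch–Tataru 2001, Theorem 1 with Lemma 3.2: the
slices of the solution `V∇ΠN` of (11) lie in `BMO⁻¹`): for `u, v` measurable on `(0, ∞) × E` with
finite Koch–Tataru norms and `t > 0`, every component `⟪B(u,v)(t), w⟫` is a bounded (hence locally
integrable and tempered) function with finite Carleson quantity
(`eCarlesonNorm_inner_kochTataruBilinear_lt_top`), hence in `BMO⁻¹` by the discharged Theorem 1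
`memBMOInv_iff_carleson_heat`; that is, `B(u, v)(t) ∈ BMO⁻¹(E; E)` given (L1) — with the
discharged (L1) this becomes the theorem (T3-bil) `memBMOInvVec_kochTataruBilinear` of
`KochTataruMild.lean`. [cite: KochTataruAdvMath2001, Theorem 1 and Lemma 3.2] -/
theorem memBMOInvVec_kochTataruBilinear_of_estimate' (hL1 : kochTataruBilinear_estimate E)
    {u v : ℝ → E → E}
    (hu : AEStronglyMeasurable (uncurry u) ((volume : Measure (ℝ × E)).restrict (Ioi 0 ×ˢ univ)))
    (hv : AEStronglyMeasurable (uncurry v) ((volume : Measure (ℝ × E)).restrict (Ioi 0 ×ˢ univ)))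
    (huX : eKochTataruNorm u < ∞) (hvX : eKochTataruNorm v < ∞) {t : ℝ} (ht : 0 < t) :
    FunctionSpaces.MemBMOInvVec (kochTataruBilinear u v t) := by
  intro w
  obtain ⟨B, -, hB⟩ := exists_norm_kochTataruBilinear_le hu hv huX hvX ht
  have hfm := stronglyMeasurable_kochTataruBilinear_slice hu hv t
  have hftemp : IsPolynomiallyTempered (kochTataruBilinear u v t) := isPolynomiallyTempered_of_bounded hfm hB
  have hgm : StronglyMeasurable (fun y => ⟪kochTataruBilinear u v t y, w⟫) := hfm.inner stronglyMeasurable_const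
  have hgB : ∀ y, ‖⟪kochTataruBilinear u v t y, w⟫‖ ≤ B * ‖w‖ := fun y =>
    (norm_inner_le_norm _ _).trans (mul_le_mul_of_nonneg_right (hB y) (norm_nonneg _))
  exact (FunctionSpaces.memBMOInv_iff_carleson_heat_holds (locallyIntegrable_of_bounded_real hgm hgB)
    (hftemp.inner_const w)).2 (eCarlesonNorm_inner_kochTataruBilinear_lt_top hL1 hu hv huX hvX ht w)

end SliceBMOInv

end Literature.Analysis.FluidPDE
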